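import Mathlib
import HarnessLib
import Literature.MathematicalPhysics.QuantumLattice.SymmetricRegimeCertificateT

/-!
# Route `WeakCouplingBCS` — crux `WcbcsBcsConstruction` (stmt-HubbardSuperconductivity-2010),
# line `ladder-scale-certified-chain`: junk guards for the scale of a v3 symmetric certificate

Stub (B) `stub_brokenRegimeAtLadderScale` of the line posits ONE universal constant `c > 0` with
`c · s ≤ dWaveOrderParameter U (ν + U/2)` whenever `symmetricRegimeCertificateT U ν (π s) Θ K Λ L₀` holds for
the ladder-scale record `π s` (scale range `[s, 2s]`, frame bound `10`), for EVERY rational `s > 0` and every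
Grassmann chemical potential `ν ∈ ℝ`.  Since `dWaveOrderParameter ≤ 4√2` always, such a `c` could only exist
if certificates at absurdly large scales `s` are impossible.  This file kernel-checks that they are, for a
GENERAL record `π : SymmetricRegimeDataT` and tolerance `Θ` (no new definition is needed):

* `not_symmetricRegimeCertificateT_of_frameBound_add_abs_le` (van Hove guard, `ν`-dependent): if
  `κ_max + |ν| ≤ Λ` there is no certificate — the van Hove point `(π, 0)` has
  `|e^c_K(π,0)| = |ν + K(π,0)| ≤ |ν| + κ_max ≤ Λ`, so it lies on the continuum shell, at distance `0 < d_vH`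
  from itself, contradicting the shell-geometry clause.
* `scale_lt_four_add_frameBound_of_certificateT` (`ν`-INDEPENDENT): every certificate has `Λ < 4 + κ_max`.
  Proof: the continuum band `e^c_K = ε - ν - K` is differentiable and `(2πℤ)²`-periodic, so it attains a
  global maximum and minimum on `[-π,π]²`, where its gradient vanishes; the speed floor `v₁ > 0` of the shell
  geometry therefore puts both extrema OFF the shell (`|e^c_K| > Λ` there).  On the other hand the
  thermodynamic block forces the LATTICE shell to be nonempty (an empty shell has Cooper matrix `0`, pairing
  strength `0 < 1/8 ≤ a`), so some value of `e^c_K` lies in `[-Λ, Λ]`; hence `max e^c_K > Λ` and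
  `min e^c_K < -Λ`, and `2Λ < max - min ≤ (4 - ν + κ_max) - (-4 - ν - κ_max) = 8 + 2κ_max`.
* Corollaries in the form the line consumes them: `not_symmetricRegimeCertificateT_of_four_add_frameBound_le`
  (`4 + κ_max ≤ Λ`), `…_le_scaleLower` (`4 + κ_max ≤ Λ₁`), `scaleLower_lt_four_add_frameBound_of_certificateT`.
  For the line's record `ladderScaleData s` (`κ_max = 10`, `Λ₁ = s`) they read: a ladder-scale certificate
  forces `s ≤ Λ < 14`, and none exists once `10 + |ν| ≤ s`; so (B)'s universal `c` is NOT secretly forced to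
  `0` by large-scale instances of its hypothesis.

* `stub_certificateScaleCeiling` — the registered sub-goal (both guards in one line):
  `symmetricRegimeCertificateT U ν π Θ K Λ L₀ → Λ < 4 + κ_max ∧ Λ < κ_max + |ν|`.

Nothing is claimed about the existence of any certificate (crux stmt-14026 / the line's stub (R)).
-/

set_option linter.dupNamespace false

noncomputable section

namespace Summit.HubbardSuperconductivity.HubbardSuperconductivity.Theorems

open Literature.MathematicalPhysics.QuantumLattice Literature.Probability.LatticeModels Filter
open scoped Topology

/-! ### Elementary facts on frames and the continuum band -/

/-- The coefficient weights of a frame increase with the order: `coeffNorm 0 K ≤ coeffNorm r K`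
(`(1 + m + n)^r ≥ 1`). [folklore] -/
theorem TrigPolyC4v.coeffNorm_zero_le (r : ℕ) (K : TrigPolyC4v) : K.coeffNorm 0 ≤ K.coeffNorm r := by
  unfold TrigPolyC4v.coeffNorm
  refine Finset.sum_le_sum fun m _ => Finset.sum_le_sum fun n _ => ?_
  refine mul_le_mul_of_nonneg_right ?_ (abs_nonneg _)
  rw [pow_zero]
  exact one_le_pow₀ (by norm_cast; omega)

/-- `sup |K| ≤ coeffNorm r K` for every order `r`. [folklore] -/
theorem TrigPolyC4v.abs_eval_le_coeffNorm_of (r : ℕ) (K : TrigPolyC4v) (p : Fin 2 → ℝ) :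
    |K.eval p| ≤ K.coeffNorm r :=
  (K.abs_eval_le_coeffNorm p).trans (TrigPolyC4v.coeffNorm_zero_le r K)

/-- The continuum band is `(2πℤ)²`-periodic. [folklore] -/
theorem renormalisedBandC_add_int_mul_two_pi (ν : ℝ) (K : TrigPolyC4v) (p : Fin 2 → ℝ) (z : Fin 2 → ℤ) :
    renormalisedBandC ν K (fun i => p i + z i * (2 * Real.pi)) = renormalisedBandC ν K p := by
  simp only [renormalisedBandC, TrigPolyC4v.eval_periodic, Real.cos_add_int_mul_two_pi]

/-- Every point of `ℝ²` has a representative modulo `(2πℤ)²` in the square `[-π,π]²` with the same band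
value. [folklore] -/
theorem exists_rep_renormalisedBandC (ν : ℝ) (K : TrigPolyC4v) (q : Fin 2 → ℝ) :
    ∃ q' : Fin 2 → ℝ, (∀ i, |q' i| ≤ Real.pi) ∧ renormalisedBandC ν K q' = renormalisedBandC ν K q := by
  have hp : (0 : ℝ) < 2 * Real.pi := Real.two_pi_pos
  refine ⟨fun i => toIcoMod hp (-Real.pi) (q i), fun i => ?_, ?_⟩
  · have hm := toIcoMod_mem_Ico hp (-Real.pi) (q i)
    rw [abs_le]
    exact ⟨hm.1, by linarith [hm.2]⟩
  · have key := renormalisedBandC_add_int_mul_two_pi ν K (fun i => toIcoMod hp (-Real.pi) (q i))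
      (fun i => toIcoDiv hp (-Real.pi) (q i))
    have hq : (fun i => toIcoMod hp (-Real.pi) (q i) + (toIcoDiv hp (-Real.pi) (q i) : ℝ) * (2 * Real.pi)) = q := by
      funext i
      have := toIcoMod_add_toIcoDiv_zsmul hp (-Real.pi) (q i)
      rw [zsmul_eq_mul] at this
      exact this
    rw [hq] at key
    exact key.symm

/-- The continuum band is differentiable. [folklore] -/
theorem differentiable_renormalisedBandC (ν : ℝ) (K : TrigPolyC4v) : Differentiable ℝ (renormalisedBandC ν K) := by
  unfold renormalisedBandC TrigPolyC4v.eval TrigPolyC4v.harmonic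
  fun_prop

/-- Pointwise bounds of the continuum band: `-4 - ν - κ ≤ e^c_K(p) ≤ 4 - ν + κ` whenever `|K| ≤ κ`.
[folklore] -/
theorem renormalisedBandC_mem_Icc {ν κ : ℝ} {K : TrigPolyC4v} (hK : ∀ p, |K.eval p| ≤ κ) (p : Fin 2 → ℝ) :
    -4 - ν - κ ≤ renormalisedBandC ν K p ∧ renormalisedBandC ν K p ≤ 4 - ν + κ := by
  have h0 := Real.neg_one_le_cos (p 0)
  have h0' := Real.cos_le_one (p 0)
  have h1 := Real.neg_one_le_cos (p 1)
  have h1' := Real.cos_le_one (p 1)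
  obtain ⟨hKl, hKu⟩ := abs_le.1 (hK p)
  unfold renormalisedBandC
  constructor <;> linarith

/-- At a global extremum of the continuum band the squared gradient vanishes. [folklore] -/
theorem gradSq_renormalisedBandC_eq_zero_of_isExtrOn {ν : ℝ} {K : TrigPolyC4v} {p : Fin 2 → ℝ}
    (h : IsExtrOn (renormalisedBandC ν K) Set.univ p) : gradSq (renormalisedBandC ν K) p = 0 := by
  have hloc : IsLocalExtr (renormalisedBandC ν K) p := h.isLocalExtr univ_mem
  have hf : fderiv ℝ (renormalisedBandC ν K) p = 0 := hloc.fderiv_eq_zero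
  simp [gradSq, partialD, hf]

/-! ### The junk guards -/

section Guards

variable {U ν : ℝ} {π : SymmetricRegimeDataT} {Θ : SymmetricTolerance} {K : TrigPolyC4v} {Λ : ℝ} {L₀ : ℕ}

/-- A certified frame is uniformly bounded by the frame bound: `|K(p)| ≤ κ_max`. [folklore] -/
theorem abs_eval_le_frameBound_of_certificateT (h : symmetricRegimeCertificateT U ν π Θ K Λ L₀) (p : Fin 2 → ℝ) :
    |K.eval p| ≤ π.frameBound :=
  (TrigPolyC4v.abs_eval_le_coeffNorm_of π.frameDecay K p).trans h.coeffNorm_le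

/-- **Van Hove guard.** If `κ_max + |ν| ≤ Λ` then `symmetricRegimeCertificateT U ν π Θ K Λ L₀` is FALSE:
the van Hove point `(π, 0)` has `|e^c_K(π, 0)| = |ν + K(π,0)| ≤ |ν| + κ_max ≤ Λ`, so it lies on the
continuum shell, where the geometry clause demands distance `≥ d_vH > 0` from `(π, 0)` itself. [folklore] -/
theorem not_symmetricRegimeCertificateT_of_frameBound_add_abs_le (U : ℝ) {ν : ℝ} (π : SymmetricRegimeDataT)
    (Θ : SymmetricTolerance) (K : TrigPolyC4v) {Λ : ℝ} (L₀ : ℕ) (hΛ : (π.frameBound : ℝ) + |ν| ≤ Λ) :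
    ¬ symmetricRegimeCertificateT U ν π Θ K Λ L₀ := by
  intro h
  have hpS : ∀ i, |(![Real.pi, 0] : Fin 2 → ℝ) i| ≤ Real.pi := by
    intro i
    fin_cases i <;> simp [abs_of_pos Real.pi_pos, Real.pi_pos.le]
  have hval : renormalisedBandC ν K ![Real.pi, 0] = -(ν + K.eval ![Real.pi, 0]) := by
    simp [renormalisedBandC]
    ring
  have hKp : |K.eval ![Real.pi, 0]| ≤ π.frameBound := abs_eval_le_frameBound_of_certificateT h _
  have hshell : |renormalisedBandC ν K ![Real.pi, 0]| ≤ Λ := by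
    rw [hval, abs_neg]
    exact (abs_add_le ν _).trans (by linarith)
  have hmem : (![Real.pi, 0] : Fin 2 → ℝ) ∈ vanHovePoints := by simp [vanHovePoints]
  have hgeom := (h.shellGeometry ![Real.pi, 0] hpS hshell).2.2 ![Real.pi, 0] hmem
  have h00 : (((![Real.pi, 0] : Fin 2 → ℝ) 0 - (![Real.pi, 0] : Fin 2 → ℝ) 0) ^ 2 +
      ((![Real.pi, 0] : Fin 2 → ℝ) 1 - (![Real.pi, 0] : Fin 2 → ℝ) 1) ^ 2 : ℝ) = 0 := by ring
  rw [h00] at hgeom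
  have hd : (0 : ℝ) < π.vanHoveDist := by exact_mod_cast π.vanHoveDist_pos
  linarith [pow_pos hd 2]

/-- **A certified lattice shell is nonempty**: the thermodynamic block of a certificate exhibits a point
(a lattice momentum of the torus of side `L₀ + 1`) with `|e^c_K| ≤ Λ` — an empty shell has Cooper matrix `0`
and pairing strength `0 < 1/8 ≤ a`. [folklore] -/
theorem exists_abs_renormalisedBandC_le_of_certificateT (h : symmetricRegimeCertificateT U ν π Θ K Λ L₀) :
    ∃ p : Fin 2 → ℝ, |renormalisedBandC ν K p| ≤ Λ := by
  obtain ⟨a, b, ha, -, -, hblock⟩ := SymmetricRegimeHoldsT.exists_window h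
  haveI : NeZero (L₀ + 1) := ⟨Nat.succ_ne_zero _⟩
  obtain ⟨β₀, hβ₀⟩ := hblock (L₀ + 1) (Nat.le_succ _)
  obtain ⟨M₀, hM₀⟩ := hβ₀ β₀ le_rfl
  haveI : NeZero (M₀ + 1) := ⟨Nat.succ_ne_zero _⟩
  have hc := hM₀ (M₀ + 1) (Nat.le_succ _)
  have hwin := hc.window.1
  by_contra hempty
  push Not at hempty
  have hshell : momentumShell (L₀ + 1) (nambuXiCT (L₀ + 1) ν K) Λ = ∅ := by
    refine Finset.eq_empty_of_forall_notMem fun k hk => ?_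
    rw [mem_momentumShell, ← renormalisedBandC_latticeMomentum] at hk
    exact (hempty _).not_ge hk
  have hC : cooperMatrix (L₀ + 1) (M₀ + 1) β₀ (nambuXiCT (L₀ + 1) ν K) Λ
      (hubbardEffectiveActionCT (L₀ + 1) (M₀ + 1) β₀ U ν 0 K Λ) = 0 := by
    ext k k'
    simp [cooperMatrix, hshell]
  have hps : pairingStrength (L₀ + 1) (M₀ + 1) β₀ (nambuXiCT (L₀ + 1) ν K) Λ
      (hubbardEffectiveActionCT (L₀ + 1) (M₀ + 1) β₀ U ν 0 K Λ) = 0 := by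
    rw [pairingStrength, hC, neg_zero]
    exact supRayleigh_zero
  rw [hps] at hwin
  have : (0 : ℝ) < a := by exact_mod_cast ha
  linarith

/-- **Scale ceiling of a certificate (`ν`-independent).** Every v3 symmetric certificate has
`Λ < 4 + κ_max`: the global maximum and minimum of the periodic continuum band `e^c_K` on `[-π,π]²` have zero
gradient, so the speed floor `v₁ > 0` puts them off the shell (`|e^c_K| > Λ`), while the nonempty lattice shell
puts a value of `e^c_K` in `[-Λ, Λ]`; hence `max e^c_K > Λ`, `min e^c_K < -Λ`, and
`2Λ < max - min ≤ 8 + 2κ_max` (`|ε| ≤ 4`, `|K| ≤ κ_max`). [folklore] -/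
theorem scale_lt_four_add_frameBound_of_certificateT (h : symmetricRegimeCertificateT U ν π Θ K Λ L₀) :
    Λ < 4 + π.frameBound := by
  -- the square is compact and nonempty, the band continuous
  have hScpt : IsCompact {p : Fin 2 → ℝ | ∀ i, |p i| ≤ Real.pi} := by
    have : {p : Fin 2 → ℝ | ∀ i, |p i| ≤ Real.pi} = Metric.closedBall 0 Real.pi := by
      ext p
      simp [Metric.mem_closedBall, dist_zero_right, pi_norm_le_iff_of_nonneg Real.pi_pos.le,
        Real.norm_eq_abs]
    rw [this]
    exact isCompact_closedBall 0 Real.pi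
  have h0S : (0 : Fin 2 → ℝ) ∈ {p : Fin 2 → ℝ | ∀ i, |p i| ≤ Real.pi} := fun i => by simp [Real.pi_pos.le]
  have hcont : Continuous (renormalisedBandC ν K) := (differentiable_renormalisedBandC ν K).continuous
  -- global extrema (periodicity moves every point into the square)
  obtain ⟨pM, hpMS, hpM⟩ := hScpt.exists_isMaxOn ⟨0, h0S⟩ hcont.continuousOn
  obtain ⟨pm, hpmS, hpm⟩ := hScpt.exists_isMinOn ⟨0, h0S⟩ hcont.continuousOn
  have hmax : ∀ q, renormalisedBandC ν K q ≤ renormalisedBandC ν K pM := fun q => by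
    obtain ⟨q', hq'S, hq'⟩ := exists_rep_renormalisedBandC ν K q
    rw [← hq']
    exact hpM hq'S
  have hmin : ∀ q, renormalisedBandC ν K pm ≤ renormalisedBandC ν K q := fun q => by
    obtain ⟨q', hq'S, hq'⟩ := exists_rep_renormalisedBandC ν K q
    rw [← hq']
    exact hpm hq'S
  have hgradM : gradSq (renormalisedBandC ν K) pM = 0 :=
    gradSq_renormalisedBandC_eq_zero_of_isExtrOn (IsMaxOn.isExtr fun q _ => hmax q)
  have hgradm : gradSq (renormalisedBandC ν K) pm = 0 :=
    gradSq_renormalisedBandC_eq_zero_of_isExtrOn (IsMinOn.isExtr fun q _ => hmin q)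
  -- the speed floor puts both extrema off the shell
  have hv : (0 : ℝ) < π.velLower := by exact_mod_cast π.velLower_pos
  have hv2 : (0 : ℝ) < (π.velLower : ℝ) ^ 2 := pow_pos hv 2
  have hgeom := h.shellGeometry
  have hoffM : Λ < |renormalisedBandC ν K pM| := by
    by_contra hle
    push Not at hle
    have := (hgeom pM hpMS hle).1.1
    rw [hgradM] at this
    linarith
  have hoffm : Λ < |renormalisedBandC ν K pm| := by
    by_contra hle
    push Not at hle
    have := (hgeom pm hpmS hle).1.1
    rw [hgradm] at this
    linarith
  -- a shell value in `[-Λ, Λ]`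
  obtain ⟨p₀, hp₀⟩ := exists_abs_renormalisedBandC_le_of_certificateT h
  obtain ⟨hp₀l, hp₀u⟩ := abs_le.1 hp₀
  have h1 := hmax p₀
  have h2 := hmin p₀
  -- band bounds
  have hK : ∀ p, |K.eval p| ≤ (π.frameBound : ℝ) := abs_eval_le_frameBound_of_certificateT h
  have hbM := (renormalisedBandC_mem_Icc (ν := ν) hK pM).2
  have hbm := (renormalisedBandC_mem_Icc (ν := ν) hK pm).1
  rw [lt_abs] at hoffM hoffm
  rcases hoffM with hM | hM <;> rcases hoffm with hm | hm <;> linarith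

/-- **No certificate at scales `Λ ≥ 4 + κ_max`**, whatever `U`, `ν`, `Θ`, `K`, `L₀`. [folklore] -/
theorem not_symmetricRegimeCertificateT_of_four_add_frameBound_le (U ν : ℝ) (π : SymmetricRegimeDataT)
    (Θ : SymmetricTolerance) (K : TrigPolyC4v) {Λ : ℝ} (L₀ : ℕ) (hΛ : 4 + (π.frameBound : ℝ) ≤ Λ) :
    ¬ symmetricRegimeCertificateT U ν π Θ K Λ L₀ := fun h =>
  ((scale_lt_four_add_frameBound_of_certificateT h).trans_le hΛ).false

/-- **No certificate for a record whose scale range starts at or above `4 + κ_max`** (`Λ₁ ≥ 4 + κ_max`;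
for the line's `ladderScaleData s`, `κ_max = 10`, `Λ₁ = s`: no ladder-scale certificate once `s ≥ 14`).
[folklore] -/
theorem not_symmetricRegimeCertificateT_of_four_add_frameBound_le_scaleLower (U ν : ℝ) (π : SymmetricRegimeDataT)
    (Θ : SymmetricTolerance) (K : TrigPolyC4v) (Λ : ℝ) (L₀ : ℕ)
    (hπ : 4 + π.frameBound ≤ π.scaleLower) : ¬ symmetricRegimeCertificateT U ν π Θ K Λ L₀ := by
  intro h
  have h1 := scale_lt_four_add_frameBound_of_certificateT h
  have h2 := h.admitsScale.1
  have h3 : (4 : ℝ) + (π.frameBound : ℝ) ≤ (π.scaleLower : ℝ) := by exact_mod_cast hπ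
  linarith

/-- **The certified scale range is bounded**: a certificate forces `Λ₁ ≤ Λ < 4 + κ_max`, so the lower end of
the record's scale range is below `4 + κ_max` (for `ladderScaleData s`: `s < 14`). [folklore] -/
theorem scaleLower_lt_four_add_frameBound_of_certificateT (h : symmetricRegimeCertificateT U ν π Θ K Λ L₀) :
    (π.scaleLower : ℝ) < 4 + π.frameBound :=
  h.admitsScale.1.trans_lt (scale_lt_four_add_frameBound_of_certificateT h)

/-- **Registered sub-goal `stub_certificateScaleCeiling` of crux stmt-HubbardSuperconductivity-2010** (junk guard for
the line `ladder-scale-certified-chain`, stub (B)): the scale of every v3 symmetric certificate is below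
`4 + κ_max` (whatever `ν`) and below `κ_max + |ν|` (van Hove guard).  For the line's record `ladderScaleData s`
(`κ_max = 10`, scale range `[s, 2s]`): `s ≤ Λ < min 14 (10 + |ν|)`. [folklore] -/
theorem stub_certificateScaleCeiling :
    ∀ (U ν : ℝ) (π : SymmetricRegimeDataT) (Θ : SymmetricTolerance) (K : TrigPolyC4v) (Λ : ℝ) (L₀ : ℕ),
      symmetricRegimeCertificateT U ν π Θ K Λ L₀ → Λ < 4 + π.frameBound ∧ Λ < π.frameBound + |ν| := by
  intro U ν π Θ K Λ L₀ h
  refine ⟨scale_lt_four_add_frameBound_of_certificateT h, not_le.1 fun hle => ?_⟩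
  exact not_symmetricRegimeCertificateT_of_frameBound_add_abs_le U π Θ K L₀ hle h

end Guards

end Summit.HubbardSuperconductivity.HubbardSuperconductivity.Theorems

end
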